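import Summits.CriticalPhenomena.PercolationContinuityZ3.Theorems.Transplant.SkelNegBParamsRootCasesT
import Summits.CriticalPhenomena.PercolationContinuityZ3.Theorems.Transplant.SkelNegBParamsRootA
import Summits.CriticalPhenomena.PercolationContinuityZ3.Theorems.Transplant.SkelPhiFaceNumsXRun
import HarnessLib

/-!
# N1 params, chain of record `NegB`, part FaceRun: THE x-FACE RUN'S START FACTS AT THE LEDGER — the tangential start half-widths `qB3X/qB3Y` with
# hp-8 g33's `hq₃` (both faces), the cross-link fit `hfit`, and the zone α-clearance `hclr` of `FloorsX` (SkelPhiFaceNumsXP :39–, p310614) at the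
# (R) origins `KS.yLs/yLd/yLt` with the zone scale `kb := M_u`, for a general per-region widening `R′` (stmt-g15 2026-08-22; (F) binder map instalment 2)
`hq₃`: the tangential run's start half-width must absorb the along run's final uncertainty `W + (N_r+1)·R′ + 2` (x-face) / `2n_L + (N_r+1)·R′` (y-face); with
`N_r + 1 ≤ 1000` the values `qB3X R′ := W + 1000·R′ + 2`, `qB3Y R′ := 2n_L + 1000·R′` serve it by monotonicity. `hfit`: `qB + (N_r+1)R′ ≤ n_L` from `4qB ≤ n_L`,
`R′ ≤ RA′`, `n_L ≥ 2000(RA′+2)`. `hclr`: `M_u < xBoxLoA n_L qB R′ k + σ·yL₀` — monotone in `k` (`R′ ≤ n_L`), and at `k = 0` the margin is `n_b − RA′ − R′`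
(case s: `≥ 24M_u + D.k + 66`), `|h_b| − RA′ − R′ − 1` (case d) and `ℓ_b − |h_b| − RA′ − R′ − 11` (case t) — the last two need **`R′ + M_u ≤ RA′`** (located (L-F4),
lane INBOX 00:37:49Z: with `R′ := RA′` they are short by `M_u − D.k − 12` / `M_u − D.k − 2` at minimal `ℓ_b`; `R′ := RlevA + 1 = RA′ − reachA` has `reachA ≥ 11(M_u+1)` to spare).
builds on p205010 (kernel theorem, internal audit signed; external expert review pending) — nothing in this file uses p205010; NOTHING is claimed about
the node `SamePDropOfSkeletonNeg₁` (OPEN; its (F) column is blocked on the named LEVEL-0 statement `hlin`, lead g7 RULING E2).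
Lane `prim-bschramm-*`, seat `prim-bschramm-stmt` (gen 15); helper file (`--supports stmt-CriticalPhenomena-4575 --as helper`); ledger HOME/prim-bschramm-stmt/NEG-PARAMS.md.
* §1 `KS.qB3X/qB3Y`, `hq₃X_R`, `hq₃Y_R`; §2 `hfitX_R`; §3 `xBoxLoA_mono`, **`hclrX_s`**, **`hclrX_d`**, **`hclrX_t`**.
[cite: KozmaNitzan2024, §4 Lemma 12 (pp. 23–25)] [cite: MartineauTassion2017, §4.3 Lemma 4.2]
-/

noncomputable section

open scoped Classical

namespace Summit.CriticalPhenomena.PercolationContinuityZ3.Theorems.Transplant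

namespace PlanarSkeletonNeg

namespace NegB

open Literature.Probability.Percolation Literature.Probability.LatticeModels SimpleGraph
open SkelConc (Consts)
open Skelφ (shearUnit shearUnit_pos xBoxLoA)
open Skelφ.StepI (DataN)
open Neg

namespace KS

/-! ## §1 The tangential start half-widths -/

section Q3

variable (κ : Consts) {V : Type} [DecidableEq V] [Countable V] {G : SimpleGraph V} [G.LocallyFinite] (Φ : PlanarSkeletonNeg G) (t : V)
  (p : unitInterval) (D : DataN V) (g f : ℕ)

/-- **The x-face's tangential (y′-run) start half-width** `qB3X R′ := W + 1000·R′ + 2` (`W = Wrun = n_Lℓ_L/U_L + 1`). [this work] -/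
def qB3X (R' : ℕ) : ℕ := Wrun κ Φ t p D g f + 1000 * R' + 2

/-- **The y′-face's tangential (x-run) start half-width** `qB3Y R′ := 2n_L + 1000·R′`. [this work] -/
def qB3Y (R' : ℕ) : ℕ := 2 * nL κ Φ t p D g f + 1000 * R'

/-- **`hq₃` (x-face)**: `W + (N_r+1)·R′ + 2 ≤ qB3X R′` whenever `N_r + 1 ≤ 1000`. [folklore] -/
theorem hq₃X_R (R' : ℕ) {Nr : ℕ} (hNr : Nr + 1 ≤ 1000) :
    ((nL κ Φ t p D g f * ℓL κ Φ t p D g f / shearUnit (nL κ Φ t p D g f) (hL κ Φ t p D g f) + 1 : ℕ) : ℤ) + ((Nr : ℤ) + 1) * R' + 2 ≤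
      (qB3X κ Φ t p D g f R' : ℤ) := by
  unfold qB3X Wrun
  have h : ((Nr : ℤ) + 1) * R' ≤ 1000 * (R' : ℤ) := by
    have : ((Nr : ℤ) + 1) ≤ 1000 := by exact_mod_cast hNr
    exact mul_le_mul_of_nonneg_right this (by positivity)
  push_cast; linarith

/-- **`hq₃` (y′-face)**: `2n_L + (N_r+1)·R′ ≤ qB3Y R′` whenever `N_r + 1 ≤ 1000`. [folklore] -/
theorem hq₃Y_R (R' : ℕ) {Nr : ℕ} (hNr : Nr + 1 ≤ 1000) :
    2 * (nL κ Φ t p D g f : ℤ) + ((Nr : ℤ) + 1) * R' ≤ (qB3Y κ Φ t p D g f R' : ℤ) := by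
  unfold qB3Y
  have h : ((Nr : ℤ) + 1) * R' ≤ 1000 * (R' : ℤ) := by
    have : ((Nr : ℤ) + 1) ≤ 1000 := by exact_mod_cast hNr
    exact mul_le_mul_of_nonneg_right this (by positivity)
  push_cast; linarith

end Q3

/-! ## §2 The cross-link fit `qB + (N_r+1)·R′ ≤ n_L` -/

section Fit

variable (κ : Consts) {V : Type} [DecidableEq V] [Countable V] {G : SimpleGraph V} [G.LocallyFinite] (Φ : PlanarSkeletonNeg G) (t : V)
  (p : unitInterval) (D : DataN V) (mk : ℕ) (gx fx : Neg.FSlot)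

/-- **`hfit`** at `(gT, fT)`: `qB + (N_r+1)·R′ ≤ n_L` for every start half-width with `4qB ≤ n_L` (all three `qBs/qBd/qBt`: `four_qBs_le`, `four_qBdt_le`),
every `R′ ≤ RA′` and `N_r + 1 ≤ 1000` (`n_L ≥ 2000(RA′+2)`). [folklore] -/
theorem hfitX_R {qB R' Nr : ℕ} (hq : 4 * qB ≤ nL κ Φ t p D (gT mk gx κ Φ t p D) (fT mk fx κ Φ t p D)) (hR : R' ≤ RA' κ Φ t p D mk)
    (hNr : Nr + 1 ≤ 1000) : (qB : ℤ) + ((Nr : ℤ) + 1) * R' ≤ (nL κ Φ t p D (gT mk gx κ Φ t p D) (fT mk fx κ Φ t p D) : ℤ) := by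
  have hn := nL_floorT_int κ Φ t p D mk fx (gT mk gx κ Φ t p D)
  have h1 : ((Nr : ℤ) + 1) * R' ≤ 1000 * (RA' κ Φ t p D mk : ℤ) := by
    have a : ((Nr : ℤ) + 1) ≤ 1000 := by exact_mod_cast hNr
    have b : (R' : ℤ) ≤ RA' κ Φ t p D mk := by exact_mod_cast hR
    calc ((Nr : ℤ) + 1) * R' ≤ 1000 * (R' : ℤ) := mul_le_mul_of_nonneg_right a (by positivity)
      _ ≤ 1000 * (RA' κ Φ t p D mk : ℤ) := by linarith
  have hq' : 4 * (qB : ℤ) ≤ nL κ Φ t p D (gT mk gx κ Φ t p D) (fT mk fx κ Φ t p D) := by exact_mod_cast hq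
  linarith

end Fit

/-! ## §3 The zone α-clearance of the x-run at the three origins, zone scale `M_u` -/

/-- `xBoxLoA n q R′ k` is monotone in `k` once `R′ ≤ n`: `xBoxLoA n q R′ 0 ≤ xBoxLoA n q R′ k`. [folklore] -/
theorem xBoxLoA_mono {n q R' : ℕ} (hR : R' ≤ n) (k : ℕ) : xBoxLoA n q R' 0 ≤ xBoxLoA n q R' k := by
  unfold Skelφ.xBoxLoA
  have hk : (0 : ℤ) ≤ k := by positivity
  have hR' : (R' : ℤ) ≤ n := by exact_mod_cast hR
  push_cast
  nlinarith

section Clear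

variable (κ : Consts) {V : Type} [DecidableEq V] [Countable V] {G : SimpleGraph V} [G.LocallyFinite] (Φ : PlanarSkeletonNeg G) (t : V)
  (p : unitInterval) (D : DataN V) (mk : ℕ) (gx fx : Neg.FSlot)

/-- `R′ ≤ n_L` at `fT` for `R′ ≤ RA′`. [folklore] -/
theorem R'_le_nL {R' : ℕ} (hR : R' ≤ RA' κ Φ t p D mk) : R' ≤ nL κ Φ t p D (gT mk gx κ Φ t p D) (fT mk fx κ Φ t p D) := by
  have hn := nL_floorT_int κ Φ t p D mk fx (gT mk gx κ Φ t p D)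
  have : (R' : ℤ) ≤ nL κ Φ t p D (gT mk gx κ Φ t p D) (fT mk fx κ Φ t p D) := by
    have b : (R' : ℤ) ≤ RA' κ Φ t p D mk := by exact_mod_cast hR
    linarith
  exact_mod_cast this

/-- **`hclr`, case same, zone scale `M_u`**: `M_u < xBoxLoA n_L qBs R′ k + σ·yLs₀` for every `k` and every `R′ ≤ RA′`
(margin at `k = 0`: `n_b − RA′ − R′ ≥ 24M_u + D.k + 66`). [folklore] -/
theorem hclrX_s {R' : ℕ} (hR : R' ≤ RA' κ Φ t p D mk) {σ : ℤ} (hσ : σ = 1 ∨ σ = -1) (k : ℕ) :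
    ((Mu D : ℕ) : ℤ) < xBoxLoA (nL κ Φ t p D (gT mk gx κ Φ t p D) (fT mk fx κ Φ t p D)) (qBs κ Φ t p D mk) R' k +
      σ * yLs κ Φ t p D (gT mk gx κ Φ t p D) (fT mk fx κ Φ t p D) mk σ 0 := by
  have hmono := xBoxLoA_mono (q := qBs κ Φ t p D mk) (R'_le_nL κ Φ t p D mk gx fx hR) k
  have hσsq : σ * σ = 1 := by rcases hσ with h | h <;> simp [h]
  have e : σ * yLs κ Φ t p D (gT mk gx κ Φ t p D) (fT mk fx κ Φ t p D) mk σ 0 = (nL κ Φ t p D (gT mk gx κ Φ t p D) (fT mk fx κ Φ t p D) : ℤ) + nBR κ Φ t p D mk := by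
    unfold yLs yLof; rw [Skelφ.pt_zero, ← mul_assoc, hσsq, one_mul]
  have h1 := (RF2_R κ Φ t p D mk).2.2
  have h2 := (bR_eq κ Φ t p D mk).1
  have h3 := (MB_floorsR κ Φ t p D mk).2.1
  have h4 : ((24 * Mu D + 63 + (D.k + 2 * RA' κ Φ t p D mk + 1) + 2 : ℕ) : ℤ) ≤ (nBR κ Φ t p D mk : ℤ) := by
    exact_mod_cast (by omega : 24 * Mu D + 63 + (D.k + 2 * RA' κ Φ t p D mk + 1) + 2 ≤ nBR κ Φ t p D mk)
  have hR' : (R' : ℤ) ≤ RA' κ Φ t p D mk := by exact_mod_cast hR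
  have e0 : xBoxLoA (nL κ Φ t p D (gT mk gx κ Φ t p D) (fT mk fx κ Φ t p D)) (qBs κ Φ t p D mk) R' 0 =
      -(qBs κ Φ t p D mk : ℤ) - R' - nL κ Φ t p D (gT mk gx κ Φ t p D) (fT mk fx κ Φ t p D) := by
    unfold Skelφ.xBoxLoA; push_cast; ring
  have hq : (qBs κ Φ t p D mk : ℤ) = RA' κ Φ t p D mk := by unfold qBs; rfl
  rw [e]; push_cast at h4; linarith

/-- **`hclr`, steep transposed case, zone scale `M_u`**: needs `R′ + M_u ≤ RA′` (margin at `k = 0`: `|h_b| − RA′ − R′ − 1 − M_u ≥ D.k + 13`,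
from `|h_b| > ℓ_b/2 ≥ bR + 13`). [folklore] -/
theorem hclrX_d {R' : ℕ} (hR : R' + Mu D ≤ RA' κ Φ t p D mk) {σ : ℤ} (hσ : σ = 1 ∨ σ = -1) (hside : ℓBR κ Φ t p D mk < 2 * (hBR κ Φ t p D mk).natAbs)
    (hℓb : 2 * bR κ Φ t p D mk + 27 ≤ ℓBR κ Φ t p D mk) (k : ℕ) :
    ((Mu D : ℕ) : ℤ) < xBoxLoA (nL κ Φ t p D (gT mk gx κ Φ t p D) (fT mk fx κ Φ t p D)) (qBd κ Φ t p D mk) R' k +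
      σ * yLd κ Φ t p D (gT mk gx κ Φ t p D) (fT mk fx κ Φ t p D) mk σ 0 := by
  have hR0 : R' ≤ RA' κ Φ t p D mk := by omega
  have hmono := xBoxLoA_mono (q := qBd κ Φ t p D mk) (R'_le_nL κ Φ t p D mk gx fx hR0) k
  have h0 := hclr_d κ Φ t p D (gT mk gx κ Φ t p D) (fT mk fx κ Φ t p D) mk hσ hside hℓb
  -- `hclr_d`: `D.k < σ·yLd₀ − qBd − RA′ − n_L`; we need `M_u < σ·yLd₀ − qBd − R′ − n_L` — but only `R′ + M_u ≤ RA′` and `0 ≤ D.k` are used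
  have hR' : (R' : ℤ) + ((Mu D : ℕ) : ℤ) ≤ RA' κ Φ t p D mk := by exact_mod_cast hR
  have hk0 : (0 : ℤ) ≤ (D.k : ℤ) := by positivity
  have e0 : xBoxLoA (nL κ Φ t p D (gT mk gx κ Φ t p D) (fT mk fx κ Φ t p D)) (qBd κ Φ t p D mk) R' 0 =
      -(qBd κ Φ t p D mk : ℤ) - R' - nL κ Φ t p D (gT mk gx κ Φ t p D) (fT mk fx κ Φ t p D) := by
    unfold Skelφ.xBoxLoA; push_cast; ring
  linarith

/-- **`hclr`, flat transposed case, zone scale `M_u`**: needs `R′ + M_u ≤ RA′` (margin at `k = 0`: `ℓ_b − |h_b| − RA′ − R′ − 11 − M_u ≥ D.k + 3`). [folklore] -/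
theorem hclrX_t {R' : ℕ} (hR : R' + Mu D ≤ RA' κ Φ t p D mk) {σ : ℤ} (hσ : σ = 1 ∨ σ = -1) (htop : 2 * (hBR κ Φ t p D mk).natAbs ≤ ℓBR κ Φ t p D mk)
    (hℓb : 2 * bR κ Φ t p D mk + 27 ≤ ℓBR κ Φ t p D mk) (k : ℕ) :
    ((Mu D : ℕ) : ℤ) < xBoxLoA (nL κ Φ t p D (gT mk gx κ Φ t p D) (fT mk fx κ Φ t p D)) (qBt κ Φ t p D mk) R' k +
      σ * yLt κ Φ t p D (gT mk gx κ Φ t p D) (fT mk fx κ Φ t p D) mk σ 0 := by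
  have hR0 : R' ≤ RA' κ Φ t p D mk := by omega
  have hmono := xBoxLoA_mono (q := qBt κ Φ t p D mk) (R'_le_nL κ Φ t p D mk gx fx hR0) k
  have h0 := hclr_t κ Φ t p D (gT mk gx κ Φ t p D) (fT mk fx κ Φ t p D) mk hσ htop hℓb
  have hR' : (R' : ℤ) + ((Mu D : ℕ) : ℤ) ≤ RA' κ Φ t p D mk := by exact_mod_cast hR
  have hk0 : (0 : ℤ) ≤ (D.k : ℤ) := by positivity
  have e0 : xBoxLoA (nL κ Φ t p D (gT mk gx κ Φ t p D) (fT mk fx κ Φ t p D)) (qBt κ Φ t p D mk) R' 0 =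
      -(qBt κ Φ t p D mk : ℤ) - R' - nL κ Φ t p D (gT mk gx κ Φ t p D) (fT mk fx κ Φ t p D) := by
    unfold Skelφ.xBoxLoA; push_cast; ring
  linarith

end Clear

end KS

end NegB

end PlanarSkeletonNeg

end Summit.CriticalPhenomena.PercolationContinuityZ3.Theorems.Transplant

end
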